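import Mathlib
import Summits.PneNP.PneNP.Theorems.ConvexRankGatesConvexGateBlindPoolPair
import Summits.PneNP.PneNP.Theorems.ConvexRankGatesConvexGateBlindCatchTwo

/-!
# PneNP / ConvexRankGates — `ConvexGateBlind`: the two pairings behind the unconditional linear ℓ₁-bound

Helpers (`--supports stmt-PneNP-10680`), COLUMN-SPACE line (prover seat 2, session 19); fifth brick. For a symmetric,
zero-diagonal, `k`-clique-non-negative `V` (`S_V(Q) = ∑_{x,y∈Q} V x y ≥ 0` on `k`-sets) and a symmetric pattern `F`:
 * POOL PAIRING (`pool_pairing`): pairing `V` with the pool measure (`k = 2r` even, `r` pools of size `n`) gives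
   `0 ≤ α_r(m)·ΣΣV + β_r(m)·ΣΣ V·rc F` — the exact pair marginals of `…PoolPair` turn `E[S_V] ≥ 0` into a linear
   inequality between the total mass and the `rc F`-weighted mass of `V`;
 * DEGREE PAIRING (`degree_pairing`): pairing `V` with the stars `{z} ∪ R` weighted by `g z ≥ 0` gives
   `0 ≤ C(m−3,k−3)·ΣΣV·Σg + 2C(m−3,k−2)·Σ_z g z·row_V(z)` (`sum_star`: the exact star average);
 * the expansion `ΣΣ V·rc F = ΣΣ V·F − 2Σ_z deg F z·row_V z/(m−2) + tot F·ΣΣV/((m−1)(m−2))` (`sum_sum_mul_poolRc`).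
`…L1Linear` combines them (with `F = [V < 0]`) into `ΣΣ|V| ≤ (32k − 35)·ΣΣV`. [new]
-/

set_option linter.dupNamespace false

namespace Summit.PneNP.PneNP.Theorems

open Finset

noncomputable section

variable {m : ℕ}

/-! ## Star averaging and the degree pairing -/

/-- **Exact star average.** For symmetric zero-diagonal `V`, `3 ≤ k ≤ m` and a vertex `z`:
`∑_{R ∈ C(V∖z, k−1)} S_V({z} ∪ R) = C(m−3,k−3)·ΣΣV + 2·C(m−3,k−2)·row_V(z)`. [new] -/
theorem sum_star (V : Fin m → Fin m → ℝ) (hV : ∀ a b, V a b = V b a) (hV0 : ∀ a, V a a = 0) (z : Fin m) {k : ℕ}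
    (hk : 3 ≤ k) (hkm : k ≤ m) :
    ∑ R ∈ ((Finset.univ : Finset (Fin m)).erase z).powersetCard (k - 1), ∑ a ∈ insert z R, ∑ b ∈ insert z R, V a b =
      ((m - 3).choose (k - 3) : ℝ) * ∑ a, ∑ b, V a b + 2 * ((m - 3).choose (k - 2) : ℝ) * ∑ b, V z b := by
  classical
  set 𝓡 := ((Finset.univ : Finset (Fin m)).erase z).powersetCard (k - 1) with h𝓡
  -- bring the sum over stars inside
  have hswap : ∑ R ∈ 𝓡, ∑ a ∈ insert z R, ∑ b ∈ insert z R, V a b =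
      ∑ a, ∑ b, V a b * ((𝓡.filter (fun R => a ∈ insert z R ∧ b ∈ insert z R)).card : ℝ) := by
    rw [Finset.sum_congr rfl (fun R _ => (sum_sum_ite_mem_and (insert z R) V).symm), Finset.sum_comm]
    refine Finset.sum_congr rfl fun a _ => ?_
    rw [Finset.sum_comm]
    refine Finset.sum_congr rfl fun b _ => ?_
    rw [← Finset.sum_filter, Finset.sum_const, nsmul_eq_mul, mul_comm]
  rw [hswap]
  -- the counts
  have hcard𝓡U : ((Finset.univ : Finset (Fin m)).erase z).card = m - 1 := by
    rw [Finset.card_erase_of_mem (Finset.mem_univ z), Finset.card_univ, Fintype.card_fin]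
  have hcount1 : ∀ b, b ≠ z → ((𝓡.filter (fun R => z ∈ insert z R ∧ b ∈ insert z R)).card : ℝ) = ((m - 2).choose (k - 2) : ℝ) := by
    intro b hbz
    have h := rb_card_filter_powersetCard_superset (B := {b}) (U := (Finset.univ : Finset (Fin m)).erase z)
      (by simpa using hbz) (c := k - 1) (by simp; omega)
    rw [hcard𝓡U, Finset.card_singleton] at h
    have e1 : m - 1 - 1 = m - 2 := by omega
    have e2 : k - 1 - 1 = k - 2 := by omega
    rw [e1, e2] at h
    have hf : 𝓡.filter (fun R => z ∈ insert z R ∧ b ∈ insert z R) =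
        𝓡.filter (fun X => ({b} : Finset (Fin m)) ⊆ X) :=
      Finset.filter_congr (fun R _ => by simp [Finset.mem_insert, hbz])
    rw [hf, h𝓡, h]
  have hcount1' : ∀ a, a ≠ z → ((𝓡.filter (fun R => a ∈ insert z R ∧ z ∈ insert z R)).card : ℝ) = ((m - 2).choose (k - 2) : ℝ) := by
    intro a haz
    rw [← hcount1 a haz]
    have hf : 𝓡.filter (fun R => a ∈ insert z R ∧ z ∈ insert z R) = 𝓡.filter (fun R => z ∈ insert z R ∧ a ∈ insert z R) :=
      Finset.filter_congr (fun R _ => by tauto)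
    rw [hf]
  have hcount2 : ∀ a b, a ≠ z → b ≠ z → a ≠ b →
      ((𝓡.filter (fun R => a ∈ insert z R ∧ b ∈ insert z R)).card : ℝ) = ((m - 3).choose (k - 3) : ℝ) := by
    intro a b haz hbz hab
    have hab2 : ({a, b} : Finset (Fin m)).card = 2 := by
      rw [Finset.card_insert_of_notMem (by simpa using hab), Finset.card_singleton]
    have h := rb_card_filter_powersetCard_superset (B := {a, b}) (U := (Finset.univ : Finset (Fin m)).erase z)
      (by simp [Finset.insert_subset_iff, haz, hbz]) (c := k - 1) (by rw [hab2]; omega)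
    rw [hcard𝓡U, hab2] at h
    have e1 : m - 1 - 2 = m - 3 := by omega
    have e2 : k - 1 - 2 = k - 3 := by omega
    rw [e1, e2] at h
    have hf : 𝓡.filter (fun R => a ∈ insert z R ∧ b ∈ insert z R) =
        𝓡.filter (fun X => ({a, b} : Finset (Fin m)) ⊆ X) :=
      Finset.filter_congr (fun R _ => by simp [Finset.mem_insert, Finset.insert_subset_iff, haz, hbz])
    rw [hf, h𝓡, h]
  have hpascal : ((m - 2).choose (k - 2) : ℝ) = ((m - 3).choose (k - 3) : ℝ) + ((m - 3).choose (k - 2) : ℝ) := by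
    have h := Nat.choose_succ_succ' (m - 3) (k - 3)
    have e1 : m - 3 + 1 = m - 2 := by omega
    have e2 : k - 3 + 1 = k - 2 := by omega
    rw [e1, e2] at h
    exact_mod_cast h
  -- pointwise evaluation of the weighted counts
  have hpt : ∀ a b, V a b * ((𝓡.filter (fun R => a ∈ insert z R ∧ b ∈ insert z R)).card : ℝ) =
      ((m - 3).choose (k - 3) : ℝ) * V a b +
        ((m - 3).choose (k - 2) : ℝ) * (V a b * (if a = z then 1 else 0) + V a b * (if b = z then 1 else 0)) := by
    intro a b
    by_cases hab : a = b
    · subst hab; rw [hV0]; ring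
    by_cases haz : a = z
    · subst haz
      rw [hcount1 b (Ne.symm hab), if_pos rfl, if_neg (Ne.symm hab), hpascal]; ring
    by_cases hbz : b = z
    · subst hbz
      rw [hcount1' a haz, if_neg haz, if_pos rfl, hpascal]; ring
    · rw [hcount2 a b haz hbz hab, if_neg haz, if_neg hbz]; ring
  rw [Finset.sum_congr rfl (fun a _ => Finset.sum_congr rfl (fun b _ => hpt a b))]
  -- the two indicator sums are the row and the column of `z`
  have hrow : ∑ a, ∑ b, V a b * (if a = z then (1 : ℝ) else 0) = ∑ b, V z b := by
    rw [Finset.sum_comm]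
    refine Finset.sum_congr rfl fun b _ => ?_
    simp_rw [mul_boole]
    rw [Finset.sum_ite_eq']
    simp
  have hcol : ∑ a, ∑ b, V a b * (if b = z then (1 : ℝ) else 0) = ∑ b, V z b := by
    have h1 : ∀ a, ∑ b, V a b * (if b = z then (1 : ℝ) else 0) = V z a := by
      intro a
      simp_rw [mul_boole]
      rw [Finset.sum_ite_eq']
      simp [hV a z]
    exact Finset.sum_congr rfl fun a _ => h1 a
  set C3 : ℝ := ((m - 3).choose (k - 3) : ℝ)
  set C2 : ℝ := ((m - 3).choose (k - 2) : ℝ)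
  have hS1 : ∑ a, ∑ b, (C3 * V a b + C2 * (V a b * (if a = z then (1 : ℝ) else 0) + V a b * (if b = z then (1 : ℝ) else 0))) =
      C3 * (∑ a, ∑ b, V a b) + C2 * (∑ a, ∑ b, V a b * (if a = z then (1 : ℝ) else 0)) +
        C2 * (∑ a, ∑ b, V a b * (if b = z then (1 : ℝ) else 0)) := by
    rw [Finset.mul_sum, Finset.mul_sum, Finset.mul_sum, ← Finset.sum_add_distrib, ← Finset.sum_add_distrib]
    refine Finset.sum_congr rfl fun a _ => ?_
    rw [Finset.mul_sum, Finset.mul_sum, Finset.mul_sum, ← Finset.sum_add_distrib, ← Finset.sum_add_distrib]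
    refine Finset.sum_congr rfl fun b _ => ?_
    ring
  rw [hS1, hrow, hcol]
  ring

/-- **Degree pairing.** For a symmetric zero-diagonal `k`-clique-non-negative `V` (`3 ≤ k ≤ m`) and vertex weights
`g ≥ 0`: `0 ≤ C(m−3,k−3)·ΣΣV·Σg + 2·C(m−3,k−2)·Σ_z g z·row_V(z)`. [new] -/
theorem degree_pairing (V : Fin m → Fin m → ℝ) (hV : ∀ a b, V a b = V b a) (hV0 : ∀ a, V a a = 0) {k : ℕ}
    (hk : 3 ≤ k) (hkm : k ≤ m)
    (hvalid : ∀ Q ∈ (Finset.univ : Finset (Fin m)).powersetCard k, 0 ≤ ∑ x ∈ Q, ∑ y ∈ Q, V x y)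
    (g : Fin m → ℝ) (hg : ∀ z, 0 ≤ g z) :
    0 ≤ ((m - 3).choose (k - 3) : ℝ) * (∑ a, ∑ b, V a b) * (∑ z, g z) +
      2 * ((m - 3).choose (k - 2) : ℝ) * ∑ z, g z * ∑ b, V z b := by
  classical
  have hstar : ∀ z, 0 ≤ g z * ∑ R ∈ ((Finset.univ : Finset (Fin m)).erase z).powersetCard (k - 1),
      ∑ a ∈ insert z R, ∑ b ∈ insert z R, V a b := by
    intro z
    refine mul_nonneg (hg z) (Finset.sum_nonneg fun R hR => hvalid _ ?_)
    rw [Finset.mem_powersetCard] at hR ⊢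
    have hzR : z ∉ R := fun h => (Finset.mem_erase.1 (hR.1 h)).1 rfl
    refine ⟨Finset.subset_univ _, ?_⟩
    rw [Finset.card_insert_of_notMem hzR, hR.2]
    omega
  have h := Finset.sum_nonneg fun z (_ : z ∈ (Finset.univ : Finset (Fin m))) => hstar z
  rw [Finset.sum_congr rfl (fun z _ => by rw [sum_star V hV hV0 z hk hkm])] at h
  have hrw : ∑ z, g z * (((m - 3).choose (k - 3) : ℝ) * ∑ a, ∑ b, V a b + 2 * ((m - 3).choose (k - 2) : ℝ) * ∑ b, V z b) =
      ((m - 3).choose (k - 3) : ℝ) * (∑ a, ∑ b, V a b) * (∑ z, g z) +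
        2 * ((m - 3).choose (k - 2) : ℝ) * ∑ z, g z * ∑ b, V z b := by
    have h1 : ((m - 3).choose (k - 3) : ℝ) * (∑ a, ∑ b, V a b) * (∑ z, g z) =
        ∑ z, g z * (((m - 3).choose (k - 3) : ℝ) * ∑ a, ∑ b, V a b) := by
      rw [Finset.mul_sum]
      exact Finset.sum_congr rfl fun z _ => by ring
    have h2 : 2 * ((m - 3).choose (k - 2) : ℝ) * ∑ z, g z * ∑ b, V z b =
        ∑ z, g z * (2 * ((m - 3).choose (k - 2) : ℝ) * ∑ b, V z b) := by
      rw [Finset.mul_sum]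
      exact Finset.sum_congr rfl fun z _ => by ring
    rw [h1, h2, ← Finset.sum_add_distrib]
    exact Finset.sum_congr rfl fun z _ => by ring
  rw [hrw] at h
  exact h

/-! ## The pool pairing -/

/-- **Pool pairing.** For a symmetric zero-diagonal `2r`-clique-non-negative `V`, a symmetric pattern `F` with non-negative
pair weights, `4 ≤ n`, `n·r ≤ m`: `0 ≤ α_r(m)·ΣΣV + β_r(m)·ΣΣ V·rc F`. [new] -/
theorem pool_pairing (η : ℝ) (n : ℕ) (F : Fin m → Fin m → ℝ) (hF : ∀ a b, F a b = F b a)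
    (hν : ∀ (P : Finset (Fin m)) (a b : Fin m), P.card = n → a ∈ P → b ∈ P → 0 ≤ poolNu η n F P a b)
    (hn : 4 ≤ n) (r : ℕ) (hnr : n * r ≤ m)
    (V : Fin m → Fin m → ℝ) (hV0 : ∀ a, V a a = 0)
    (hvalid : ∀ Q ∈ (Finset.univ : Finset (Fin m)).powersetCard (2 * r), 0 ≤ ∑ x ∈ Q, ∑ y ∈ Q, V x y) :
    0 ≤ poolAlpha r m * (∑ a, ∑ b, V a b) +
      poolBeta η n r m * ∑ a, ∑ b, V a b * poolRc (Finset.univ : Finset (Fin m)) F a b := by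
  classical
  have hU : n * r ≤ (Finset.univ : Finset (Fin m)).card := by rwa [Finset.card_univ, Fintype.card_fin]
  have h0 : 0 ≤ poolE η n F r Finset.univ (fun Q => ∑ a ∈ Q, ∑ b ∈ Q, V a b) :=
    poolE_nonneg η n F hν r _ _ (fun Q _ hQc => hvalid Q (Finset.mem_powersetCard.2 ⟨Finset.subset_univ _, hQc⟩))
  have hfun : (fun Q : Finset (Fin m) => ∑ a ∈ Q, ∑ b ∈ Q, V a b) =
      fun Q => ∑ a, ∑ b, V a b * (if a ∈ Q ∧ b ∈ Q then (1 : ℝ) else 0) := by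
    funext Q
    rw [← sum_sum_ite_mem_and Q V]
    refine Finset.sum_congr rfl fun a _ => Finset.sum_congr rfl fun b _ => ?_
    split_ifs <;> simp
  rw [hfun, poolE_sum] at h0
  rw [Finset.sum_congr rfl (fun a _ => by rw [poolE_sum])] at h0
  have hterm : ∀ a b, poolE η n F r Finset.univ (fun Q => V a b * (if a ∈ Q ∧ b ∈ Q then (1 : ℝ) else 0)) =
      V a b * (poolAlpha r m + poolBeta η n r m * poolRc (Finset.univ : Finset (Fin m)) F a b) := by
    intro a b
    rw [poolE_smul]
    by_cases hab : a = b
    · subst hab; rw [hV0]; ring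
    · rw [poolE_pair η n F hF hn hab r _ hU, if_pos ⟨Finset.mem_univ a, Finset.mem_univ b⟩, Finset.card_univ,
        Fintype.card_fin]
  rw [Finset.sum_congr rfl (fun a _ => Finset.sum_congr rfl (fun b _ => hterm a b))] at h0
  have hrw : ∑ a, ∑ b, V a b * (poolAlpha r m + poolBeta η n r m * poolRc (Finset.univ : Finset (Fin m)) F a b) =
      poolAlpha r m * (∑ a, ∑ b, V a b) + poolBeta η n r m * ∑ a, ∑ b, V a b * poolRc Finset.univ F a b := by
    rw [Finset.mul_sum, Finset.mul_sum, ← Finset.sum_add_distrib]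
    refine Finset.sum_congr rfl fun a _ => ?_
    rw [Finset.mul_sum, Finset.mul_sum, ← Finset.sum_add_distrib]
    refine Finset.sum_congr rfl fun b _ => ?_
    ring
  rw [hrw] at h0
  exact h0

/-! ## Expanding the re-centred pattern against `V` -/

/-- **Expansion** `ΣΣ V·rc_univ F = ΣΣ V·F − 2·Σ_z deg F z·row_V z/(m−2) + tot F·ΣΣV/((m−1)(m−2))` for symmetric `V`. [new] -/
theorem sum_sum_mul_poolRc (V F : Fin m → Fin m → ℝ) (hV : ∀ a b, V a b = V b a) :
    ∑ a, ∑ b, V a b * poolRc (Finset.univ : Finset (Fin m)) F a b =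
      ∑ a, ∑ b, V a b * F a b -
        2 * (∑ z, poolDeg (Finset.univ : Finset (Fin m)) F z * ∑ b, V z b) / ((m : ℝ) - 2) +
        poolTot (Finset.univ : Finset (Fin m)) F * (∑ a, ∑ b, V a b) / (((m : ℝ) - 1) * ((m : ℝ) - 2)) := by
  have hcard : ((Finset.univ : Finset (Fin m)).card : ℝ) = m := by rw [Finset.card_univ, Fintype.card_fin]
  set g : Fin m → ℝ := fun z => poolDeg (Finset.univ : Finset (Fin m)) F z with hg
  set T : ℝ := poolTot (Finset.univ : Finset (Fin m)) F with hT
  have hpt : ∀ a b, V a b * poolRc (Finset.univ : Finset (Fin m)) F a b =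
      V a b * F a b - (V a b * g a + V a b * g b) / ((m : ℝ) - 2) + V a b * T / (((m : ℝ) - 1) * ((m : ℝ) - 2)) := by
    intro a b
    unfold poolRc
    rw [hcard]
    ring
  rw [Finset.sum_congr rfl (fun a _ => Finset.sum_congr rfl (fun b _ => hpt a b))]
  simp only [Finset.sum_add_distrib, Finset.sum_sub_distrib]
  -- the degree term
  have hA : ∑ a, ∑ b, V a b * g a = ∑ z, g z * ∑ b, V z b := by
    refine Finset.sum_congr rfl fun a _ => ?_
    rw [Finset.mul_sum]
    exact Finset.sum_congr rfl fun b _ => by ring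
  have hB : ∑ a, ∑ b, V a b * g b = ∑ z, g z * ∑ b, V z b := by
    rw [Finset.sum_comm]
    refine Finset.sum_congr rfl fun b _ => ?_
    rw [Finset.mul_sum]
    exact Finset.sum_congr rfl fun a _ => by rw [hV a b]; ring
  have hdeg : ∑ a, ∑ b, (V a b * g a + V a b * g b) / ((m : ℝ) - 2) =
      2 * (∑ z, g z * ∑ b, V z b) / ((m : ℝ) - 2) := by
    rw [two_mul]
    nth_rewrite 1 [← hA]
    rw [← hB, ← Finset.sum_add_distrib, Finset.sum_div]
    refine Finset.sum_congr rfl fun a _ => ?_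
    rw [← Finset.sum_add_distrib, Finset.sum_div]
  have htot : ∑ a, ∑ b, V a b * T / (((m : ℝ) - 1) * ((m : ℝ) - 2)) =
      T * (∑ a, ∑ b, V a b) / (((m : ℝ) - 1) * ((m : ℝ) - 2)) := by
    rw [Finset.mul_sum, Finset.sum_div]
    refine Finset.sum_congr rfl fun a _ => ?_
    rw [Finset.mul_sum, Finset.sum_div]
    refine Finset.sum_congr rfl fun b _ => ?_
    ring
  rw [hdeg, htot]

/-- **Pool pairing** (registered form of `pool_pairing`). [new] -/
theorem pool_pairing_sum : ∀ {m : ℕ} (η : ℝ) (n : ℕ) (F : Fin m → Fin m → ℝ), (∀ a b, F a b = F b a) → (∀ (P : Finset (Fin m)) (a b : Fin m), P.card = n → a ∈ P → b ∈ P → 0 ≤ poolNu η n F P a b) → 4 ≤ n → ∀ (r : ℕ), n * r ≤ m → ∀ (V : Fin m → Fin m → ℝ), (∀ a, V a a = 0) → (∀ Q ∈ (Finset.univ : Finset (Fin m)).powersetCard (2 * r), 0 ≤ ∑ x ∈ Q, ∑ y ∈ Q, V x y) → 0 ≤ poolAlpha r m * (∑ a, ∑ b, V a b) + poolBeta η n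 r m * ∑ a, ∑ b, V a b * poolRc (Finset.univ : Finset (Fin m)) F a b :=
  fun η n F hF hν hn r hnr V hV0 hvalid => pool_pairing η n F hF hν hn r hnr V hV0 hvalid

end

end Summit.PneNP.PneNP.Theorems
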